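import Summits.Ventures.CertifiedManyBodySolver.Theorems.M3x2EdgeSplitSymReplayOutRouteMFZ
import HarnessLib

/-!
# SymReplay — lever (β⁺) DENSE INTEGER DOTS: the per-hit Gram dot as a native `zipWith`/`sum` over densified `ℤ` rows

(team lb-sym, cell hub-lb; hub-lb-sym-eng-4 g3, 2026-08-28.  ADDITIVE on the pen's `…OutRouteMFZ` (hub-lb-sym-plan-1 g4 spec,
lever (β) of EBUDGET-600 §10: sparse `ℤ` dots `sdotZ`, lifting identity `sdot_liftRow`, side fact `liftOKR`, bridge
`shareRFastMFZ_eq`) and on `…OutRouteMF/PF`; nothing landed is touched.)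

WHY (measured, STATUS 2026-08-28 hub-lb-sym-eng-4 g3 «β BENCH», real rung-V certificate, interpreted = gate mode).  The Gram rows of
record are integer-valued (`D = 1` on all 85 blocks) and dense (112 545 entries in 112 546 width-cells).  Per dot on block 0
(130 × 130): `sdot` (ℚ merge) 203–262 µs · `sdotZ` (ℤ merge, interpreted) 144 µs · **`ddot` = `(List.zipWith (·*·) u v).sum` on
dense `ℤ` vectors 23 µs** — `List.zipWith` / `List.sum` / `Int.mul` / `Int.add` are core functions, so the interpreter runs them as
native code (0.18 µs per 75-bit product), while every step of a tree-defined merge is interpreted (≈ 1.1 µs).  Module body (coarse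
key, `J = 8`, `L = 1`, module 0, 190 610 hits): `shareRFastMF` 33.2 s → `shareRFastMFZ` 21.7–24.4 s → **`shareRFastMFD` 15.3 s**, same list.

HOW.  Per block (once per module): `D := blockDen B`, integer rows `blockRowsZ B` (pen), block width `N := blockWidth B` (one more
than the largest column), DENSIFIED rows `dvN N rz` (zeros filled — triangular / sparse factors stay sound), and the block constant
`kb := −(|moves| · scale) / D²` folded once; per hit `stepOptD` reads `g := ddot aD xD` and emits `kb · g · (c · c')`.
SOUNDNESS = list equality with the landed enumerator: `sdotZF_eq_ddot` (merge = dense on rows with ascending columns below the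
width), `stepOptD_eq` (= pen's `stepOptZ`, coefficient by `ring`), `rowFastFD_eq`, `shareRWithMFD_eq_MFZ`, **`shareRFastMFD_eq :
shareRFastMFD … = shareRFastMF …`** under the pen's `liftOKR K` AND the new side fact **`denseOKR K`** (every integerised row has
strictly ascending columns `< blockWidth`; one cheap global `native_decide`, 0.4 s with `liftOKR` at rung V), and the closing
**`energyDensity_ge_of_outroutePMFD0`** (= `…PMF0` with the dense share).  MODULE GRAMMAR (E-class, hierarchical coarse routing):
per module `m < J·L`: `out_m : PackedNF.pisZero (PackedNF.pcanonNFZHBZ lo hi PackedNF.oracleV3 (PackedNF.encP lo hi (shareRFastMFD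
momSpecC cert gbs tabC κ₂ J L (m / L) (m % L)))) = true := by native_decide`; globals `hZ : liftOKR cert = true`, `hD : denseOKR cert =
true` (by `native_decide`, one module with `hcov`); close `energyDensity_ge_of_outroutePMFD0 momSpecC cert hwf hRok PackedNF.oracleV3
tabC κ₂ J L hJ hL lo hi hbox hcov hZ hD hfacts`.  Standard axioms; no `native_decide` in this file.

HONEST FRAMING: an interpreted replay-COST lever with its equality proofs; certifies nothing; no bound of record moves; tree floor
−0.8942613047 (rung V, computational) unchanged; no summit or crux statement is proved here; nothing here predicts superconductivity.
-/

namespace Summit.Ventures.CertifiedManyBodySolver.Theorems.SymReplay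

open Literature.MathematicalPhysics.QuantumLattice
open Literature.MathematicalPhysics.QuantumLattice.HubbardWave0
open Literature.MathematicalPhysics.QuantumLattice.ThermodynamicLimit
open Literature.Probability.LatticeModels
open Literature.MathematicalPhysics.QuantumManyBody.StateRelaxation
open Summit.Ventures.CertifiedManyBodySolver.Theorems.WardSlot

/-! ##### (a) the dense integer dot, the densifier, and `merge = dense` -/

/-- **Dense integer dot.**  `List.zipWith`, `List.sum`, `Int.mul`, `Int.add` are core functions: under the interpreter this is
native code (0.18 µs per element on 75-bit products), ≈ 9× cheaper per dot than the interpreted sparse merge. -/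
def ddot (u v : List ℤ) : ℤ := (List.zipWith (· * ·) u v).sum

/-- `ddot` against the empty vector (left). -/
@[simp] theorem ddot_nil_left (v : List ℤ) : ddot [] v = 0 := by simp [ddot]

/-- `ddot` against the empty vector (right). -/
@[simp] theorem ddot_nil_right (u : List ℤ) : ddot u [] = 0 := by cases u <;> simp [ddot]

/-- `ddot` step. -/
@[simp] theorem ddot_cons (a b : ℤ) (u v : List ℤ) : ddot (a :: u) (b :: v) = a * b + ddot u v := by simp [ddot]

/-- **Densifier**: the sparse integer row laid out over the `f` columns `k, k+1, …, k+f−1` (zero where a column is absent). -/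
def dvF : ℕ → ℕ → List (ℤ × ℕ) → List ℤ
  | _, 0, _ => []
  | k, f + 1, [] => 0 :: dvF (k + 1) f []
  | k, f + 1, (a, i) :: r => if i = k then a :: dvF (k + 1) f r else 0 :: dvF (k + 1) f ((a, i) :: r)

/-- Dense vector of a sparse integer row over columns `0 … N−1`. -/
def dvN (N : ℕ) (rz : List (ℤ × ℕ)) : List ℤ := dvF 0 N rz

/-- Column discipline of the dense path: columns `≥ k`, strictly ascending, all `< N`. -/
def colsAscLt : ℕ → List (ℤ × ℕ) → ℕ → Bool
  | _, [], _ => true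
  | k, (_, i) :: r, N => decide (k ≤ i) && decide (i < N) && colsAscLt (i + 1) r N

/-- A row the dense path may read: strictly ascending columns below the block width `N`. -/
def rowOKZ (N : ℕ) (rz : List (ℤ × ℕ)) : Bool := colsAscLt 0 rz N

/-- The densification of the empty row is orthogonal to everything (left). -/
theorem ddot_dvF_nil_left : ∀ (f k : ℕ) (v : List ℤ), ddot (dvF k f []) v = 0
  | 0, k, v => by simp [dvF]
  | f + 1, k, [] => by simp
  | f + 1, k, b :: v => by rw [dvF, ddot_cons, ddot_dvF_nil_left f (k + 1) v]; simp

/-- The densification of the empty row is orthogonal to everything (right). -/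
theorem ddot_dvF_nil_right : ∀ (f k : ℕ) (u : List ℤ), ddot u (dvF k f []) = 0
  | 0, k, u => by simp [dvF]
  | f + 1, k, [] => by simp
  | f + 1, k, a :: u => by rw [dvF, ddot_cons, ddot_dvF_nil_right f (k + 1) u]; simp

/-- No row has columns in the empty range `[k, k)`. -/
theorem eq_nil_of_colsAscLt {k : ℕ} : ∀ {r : List (ℤ × ℕ)}, colsAscLt k r k = true → r = []
  | [], _ => rfl
  | (a, i) :: r, h => by
    simp only [colsAscLt, Bool.and_eq_true, decide_eq_true_eq] at h
    omega

/-- `sdotZF` with both rows empty. -/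
theorem sdotZF_nil_nil (n : ℕ) (acc : ℤ) : sdotZF n [] [] acc = acc := by cases n <;> rfl

/-- `sdotZF` with the left row empty. -/
theorem sdotZF_nil_left (n : ℕ) (r' : List (ℤ × ℕ)) (acc : ℤ) : sdotZF n [] r' acc = acc := by
  cases n <;> cases r' <;> rfl

/-- `sdotZF` with the right row empty. -/
theorem sdotZF_nil_right (n : ℕ) (r : List (ℤ × ℕ)) (acc : ℤ) : sdotZF n r [] acc = acc := by
  cases n with
  | zero => rfl
  | succ n => cases r with
    | nil => rfl
    | cons e r => obtain ⟨a, i⟩ := e; rfl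

/-- **MERGE = DENSE.**  On rows with strictly ascending columns in `[k, k+f)` the pen's sparse integer merge `sdotZF` (any
sufficient fuel) is the dense dot of the densified rows. -/
theorem sdotZF_eq_ddot : ∀ (f k : ℕ) (r r' : List (ℤ × ℕ)) (acc : ℤ) (n : ℕ),
    colsAscLt k r (k + f) = true → colsAscLt k r' (k + f) = true → r.length + r'.length ≤ n →
    sdotZF n r r' acc = acc + ddot (dvF k f r) (dvF k f r')
  | 0, k, r, r', acc, n, hr, hr', _ => by
    rw [Nat.add_zero] at hr hr'
    rw [eq_nil_of_colsAscLt hr, eq_nil_of_colsAscLt hr', sdotZF_nil_nil]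
    simp [dvF]
  | f + 1, k, [], r', acc, n, _, _, _ => by
    rw [sdotZF_nil_left, ddot_dvF_nil_left, add_zero]
  | f + 1, k, (a, i) :: r, [], acc, n, _, _, _ => by
    rw [sdotZF_nil_right, ddot_dvF_nil_right, add_zero]
  | f + 1, k, (a, i) :: r, (b, j) :: r', acc, n, hr, hr', hn => by
    simp only [colsAscLt, Bool.and_eq_true, decide_eq_true_eq] at hr hr'
    obtain ⟨⟨hki, hif⟩, hr⟩ := hr
    obtain ⟨⟨hkj, hjf⟩, hr'⟩ := hr'
    have hf : k + (f + 1) = k + 1 + f := by omega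
    rw [hf] at hr hr' hif hjf
    by_cases hi : i = k
    · subst hi
      by_cases hj : j = i
      · -- both rows have column `k`: the merge accumulates `a * b`, the dense vectors start with `a`, `b`
        subst hj
        obtain ⟨n₁, rfl⟩ : ∃ n₁, n = n₁ + 1 := ⟨n - 1, by simp only [List.length_cons] at hn; omega⟩
        have hn₁ : r.length + r'.length ≤ n₁ := by simp only [List.length_cons] at hn; omega
        rw [dvF, if_pos rfl, dvF, if_pos rfl, ddot_cons, sdotZF, if_neg (lt_irrefl j), if_neg (lt_irrefl j),
          sdotZF_eq_ddot f (j + 1) r r' (acc + a * b) n₁ hr hr' hn₁, add_assoc]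
      · -- only the left row has column `k`
        have hkj' : i + 1 ≤ j := by omega
        obtain ⟨n₁, rfl⟩ : ∃ n₁, n = n₁ + 1 := ⟨n - 1, by simp only [List.length_cons] at hn; omega⟩
        have hn₁ : r.length + ((b, j) :: r').length ≤ n₁ := by simp only [List.length_cons] at hn ⊢; omega
        have hR : colsAscLt (i + 1) ((b, j) :: r') (i + 1 + f) = true := by
          simp only [colsAscLt, Bool.and_eq_true, decide_eq_true_eq]; exact ⟨⟨hkj', hjf⟩, hr'⟩
        rw [dvF, if_pos rfl, dvF, if_neg hj, ddot_cons, mul_zero, zero_add, sdotZF, if_pos (by omega),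
          sdotZF_eq_ddot f (i + 1) r ((b, j) :: r') acc n₁ hr hR hn₁]
    · by_cases hj : j = k
      · -- only the right row has column `k`
        subst hj
        have hki' : j + 1 ≤ i := by omega
        obtain ⟨n₁, rfl⟩ : ∃ n₁, n = n₁ + 1 := ⟨n - 1, by simp only [List.length_cons] at hn; omega⟩
        have hn₁ : ((a, i) :: r).length + r'.length ≤ n₁ := by simp only [List.length_cons] at hn ⊢; omega
        have hL : colsAscLt (j + 1) ((a, i) :: r) (j + 1 + f) = true := by
          simp only [colsAscLt, Bool.and_eq_true, decide_eq_true_eq]; exact ⟨⟨hki', hif⟩, hr⟩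
        rw [dvF, if_neg hi, dvF, if_pos rfl, ddot_cons, zero_mul, zero_add, sdotZF, if_neg (by omega), if_pos (by omega),
          sdotZF_eq_ddot f (j + 1) ((a, i) :: r) r' acc n₁ hL hr' hn₁]
      · -- neither row has column `k`: the merge does not move, the dense vectors both start with `0`
        have hL : colsAscLt (k + 1) ((a, i) :: r) (k + 1 + f) = true := by
          simp only [colsAscLt, Bool.and_eq_true, decide_eq_true_eq]; exact ⟨⟨by omega, hif⟩, hr⟩
        have hR : colsAscLt (k + 1) ((b, j) :: r') (k + 1 + f) = true := by
          simp only [colsAscLt, Bool.and_eq_true, decide_eq_true_eq]; exact ⟨⟨by omega, hjf⟩, hr'⟩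
        rw [dvF, if_neg hi, dvF, if_neg hj, ddot_cons, zero_mul, zero_add,
          sdotZF_eq_ddot f (k + 1) ((a, i) :: r) ((b, j) :: r') acc n hL hR hn]

/-- **The pen's sparse integer dot IS the dense dot of the densified rows** (rows the dense path may read). -/
theorem sdotZ_eq_ddot (N : ℕ) (rz rz' : List (ℤ × ℕ)) (h : rowOKZ N rz = true) (h' : rowOKZ N rz' = true) :
    sdotZ rz rz' = ddot (dvN N rz) (dvN N rz') := by
  have h0 := sdotZF_eq_ddot N 0 rz rz' 0 (rz.length + rz'.length) (by simpa [rowOKZ] using h)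
    (by simpa [rowOKZ] using h') le_rfl
  simpa [sdotZ, dvN] using h0

/-! ##### (b) the per-hit step with a dense dot and the block constant folded -/

/-- Per-hit step with a DENSE integer dot; `kb = −(m·s)/D²` is computed once per block (3 `Rat` products per hit instead of 5). -/
def stepOptD (aD : List ℤ) (kb : ℚ) (t : ℚ × Word) (x : List ℤ × (ℚ × Word)) : Option (ℚ × Word) :=
  let g := ddot aD x.1
  if g = 0 then none else some (kb * (g : ℚ) * (t.1 * x.2.1), t.2 ++ x.2.2)

/-- **`stepOptD` IS the pen's `stepOptZ`** on rows the dense path may read (coefficient identity by `ring`). -/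
theorem stepOptD_eq (N : ℕ) (D : ℚ) (aZ : List (ℤ × ℕ)) (haZ : rowOKZ N aZ = true) (m s : ℚ) (t : ℚ × Word)
    (x : List (ℤ × ℕ) × (ℚ × Word)) (hx : rowOKZ N x.1 = true) :
    stepOptD (dvN N aZ) (-1 * (m * s) / (D * D)) t (dvN N x.1, x.2) = stepOptZ aZ m s (1 / (D * D)) t x := by
  obtain ⟨xz, cw⟩ := x
  unfold stepOptD stepOptZ
  simp only [← sdotZ_eq_ddot N aZ xz haZ hx]
  by_cases hg : sdotZ aZ xz = 0
  · simp [hg]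
  · rw [if_neg hg, if_neg hg]
    congr 1
    refine Prod.ext ?_ rfl
    show -1 * (m * s) / (D * D) * (sdotZ aZ xz : ℚ) * (t.1 * cw.1) = -1 * (m * (s * ((sdotZ aZ xz : ℚ) * (1 / (D * D))))) * (t.1 * cw.1)
    ring

/-! ##### (c) the dense enumerator, its side fact, the list bridge, the closing -/

section DenseRows

variable {M : Type} [DecidableEq M] [Hashable M]

/-- Tagged basis terms with DENSE integer rows `(xD_j, (c', w))`. -/
def wflatD (qd : List (QPoly × List ℤ)) : List (List ℤ × (ℚ × Word)) :=
  qd.flatMap fun b => b.1.map fun t' => (b.2, t')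

/-- **One representative row, secondary test before the DENSE dot.** -/
def rowFastFD (S : MomSpec M) (a : QPoly × List ℤ) (wmap : Std.HashMap M (List (List ℤ × (ℚ × Word))))
    (kb : ℚ) (T : List M) (P₂ : Word → Bool) : QPoly :=
  (padj a.1).flatMap fun t =>
    T.flatMap fun mt =>
      (wmap.getD (S.sub mt (mom S t.2)) []).filterMap fun x =>
        if P₂ (t.2 ++ x.2.2) then stepOptD a.2 kb t x else none

/-- **Block width**: one more than the largest column index occurring in the block's rows. -/
def blockWidth (B : GramBlockR) : ℕ := B.rows.foldl (fun w r => r.foldl (fun w e => max w (e.2 + 1)) w) 0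

/-- Densified integer rows of a block. -/
def blockRowsD (B : GramBlockR) : List (List ℤ) := (blockRowsZ B).map (dvN (blockWidth B))

/-- **R-part of sub-module `(i, f)` with dense integer dots** (twin of `shareRWithMF` / the pen's `shareRWithMFZ`). -/
def shareRWithMFD (S : MomSpec M) (K : SymCertR) (gbs : List (List QPoly)) (T : List M) (P₂ : Word → Bool) : QPoly :=
  (K.gramR.zip gbs).flatMap fun Bg =>
    let D := blockDen Bg.1
    let rd := blockRowsD Bg.1
    let kb : ℚ := -1 * ((Bg.1.moves.length : ℚ) * Bg.1.scale) / ((D : ℚ) * D)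
    let wmap := bucketBy (fun x : List ℤ × (ℚ × Word) => mom S x.2.2) (wflatD (Bg.2.zip rd))
    (Bg.1.reps.zip rd).flatMap fun a => rowFastFD S a wmap kb T P₂

/-- **Sub-module `(i, f)`'s share with dense integer dots** (twin of `shareRFastMF`; same list, `shareRFastMFD_eq`). -/
def shareRFastMFD (S : MomSpec M) (K : SymCertR) (gbs : List (List QPoly)) (hm : MomTable M) (κ₂ : Word → ℕ)
    (J L i f : ℕ) : QPoly :=
  let P := wordPred (inSlotW (momKey S hm) J i)
  let P₂ : Word → Bool := fun w => κ₂ w % L == f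
  (baseShareF K.toSymCert P).filter (wordPred P₂) ++
  ((pscale (-1) (K.gramM.flatMap fun B => (gramBlockPoly B).filter P)).filter (wordPred P₂) ++
    shareRWithMFD S K gbs (targetsM hm J i) P₂)

/-- **The side fact of the dense path**: every integerised row of every R-block has strictly ascending columns below its block
width (one cheap global `native_decide`, next to the pen's `liftOKR`). -/
def denseOKR (K : SymCertR) : Bool :=
  K.gramR.all fun B => (blockRowsZ B).all (rowOKZ (blockWidth B))

/-- `wflatD` of densified rows is the densification of the pen's `wflatZ`. -/
theorem wflatD_map (N : ℕ) : ∀ (qrz : List (QPoly × List (ℤ × ℕ))),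
    wflatD (qrz.map fun b => (b.1, dvN N b.2)) = (wflatZ qrz).map fun x => (dvN N x.1, x.2)
  | [] => rfl
  | b :: qrz => by
    have ih := wflatD_map N qrz
    simp only [wflatD, wflatZ, List.map_cons, List.flatMap_cons, List.map_append, List.map_map] at ih ⊢
    rw [ih]
    rfl

/-- The row of a tagged term of `wflatZ qrz` is a row of `qrz`. -/
theorem mem_wflatZ {qrz : List (QPoly × List (ℤ × ℕ))} {x : List (ℤ × ℕ) × (ℚ × Word)} (hx : x ∈ wflatZ qrz) :
    ∃ b ∈ qrz, x.1 = b.2 := by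
  simp only [wflatZ, List.mem_flatMap, List.mem_map] at hx
  obtain ⟨b, hb, t', _, rfl⟩ := hx
  exact ⟨b, hb, rfl⟩

/-- **Dense row = the pen's sparse-ℤ row** when the representative row and all tagged rows may be read densely. -/
theorem rowFastFD_eq (S : MomSpec M) (N : ℕ) (D : ℚ) (p : QPoly) (aZ : List (ℤ × ℕ)) (haZ : rowOKZ N aZ = true)
    (qrz : List (QPoly × List (ℤ × ℕ))) (hq : ∀ b ∈ qrz, rowOKZ N b.2 = true) (m s : ℚ) (T : List M)
    (P₂ : Word → Bool) :
    rowFastFD S (p, dvN N aZ) (bucketBy (fun x : List ℤ × (ℚ × Word) => mom S x.2.2)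
        (wflatD (qrz.map fun b => (b.1, dvN N b.2)))) (-1 * (m * s) / (D * D)) T P₂ =
      rowFastFZ S (p, aZ) (bucketBy (fun x : List (ℤ × ℕ) × (ℚ × Word) => mom S x.2.2) (wflatZ qrz)) m s
        (1 / (D * D)) T P₂ := by
  unfold rowFastFD rowFastFZ
  refine List.flatMap_congr fun t _ => List.flatMap_congr fun mt _ => ?_
  rw [bucketBy_getD, bucketBy_getD, wflatD_map, List.filter_map, ← List.map_reverse, List.filterMap_map]
  have hf : ((fun x : List ℤ × (ℚ × Word) => decide (mom S x.2.2 = S.sub mt (mom S t.2))) ∘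
      fun x : List (ℤ × ℕ) × (ℚ × Word) => (dvN N x.1, x.2)) =
      fun x => decide (mom S x.2.2 = S.sub mt (mom S t.2)) := rfl
  rw [hf]
  refine List.filterMap_congr fun x hx => ?_
  obtain ⟨b, hb, hxb⟩ := mem_wflatZ (List.mem_filter.1 (List.mem_reverse.1 hx)).1
  have hxOK : rowOKZ N x.1 = true := hxb ▸ hq b hb
  rw [Function.comp_apply, stepOptD_eq N D aZ haZ m s t x hxOK]

/-- **Dense R-part = the pen's sparse-ℤ R-part** under the dense side fact. -/
theorem shareRWithMFD_eq_MFZ (S : MomSpec M) (K : SymCertR) (hD : denseOKR K = true) (gbs : List (List QPoly)) (T : List M)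
    (P₂ : Word → Bool) : shareRWithMFD S K gbs T P₂ = shareRWithMFZ S K gbs T P₂ := by
  unfold shareRWithMFD shareRWithMFZ
  refine List.flatMap_congr fun Bg hBg => ?_
  have hB : Bg.1 ∈ K.gramR := (List.of_mem_zip hBg).1
  unfold denseOKR at hD
  have hrows : ∀ rz ∈ blockRowsZ Bg.1, rowOKZ (blockWidth Bg.1) rz = true :=
    List.all_eq_true.1 (List.all_eq_true.1 hD Bg.1 hB)
  have hzip : ∀ (l : List (QPoly × List (ℤ × ℕ))), l.map (Prod.map id (dvN (blockWidth Bg.1))) =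
      l.map fun b => (b.1, dvN (blockWidth Bg.1) b.2) :=
    fun l => List.map_congr_left fun b _ => by cases b; rfl
  simp only [blockRowsD, List.zip_map_right, PackedNF.flatMap_map_left, hzip]
  refine List.flatMap_congr fun a ha => ?_
  obtain ⟨p, aZ⟩ := a
  have haZ : rowOKZ (blockWidth Bg.1) aZ = true := hrows aZ (List.of_mem_zip ha).2
  have hq : ∀ b ∈ Bg.2.zip (blockRowsZ Bg.1), rowOKZ (blockWidth Bg.1) b.2 = true :=
    fun b hb => hrows b.2 (List.of_mem_zip hb).2
  exact rowFastFD_eq S (blockWidth Bg.1) _ p aZ haZ _ hq _ _ T P₂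

/-- **Dense R-part = R-part of record** (pen's bridge composed). -/
theorem shareRWithMFD_eq (S : MomSpec M) (K : SymCertR) (hZ : liftOKR K = true) (hD : denseOKR K = true)
    (gbs : List (List QPoly)) (T : List M) (P₂ : Word → Bool) : shareRWithMFD S K gbs T P₂ = shareRWithMF S K gbs T P₂ :=
  (shareRWithMFD_eq_MFZ S K hD gbs T P₂).trans (shareRWithMFZ_eq S K hZ gbs T P₂)

/-- **THE BRIDGE: the dense-dot share IS the landed hierarchical share** (same list) — every `…OutRouteMF/PF` theorem applies. -/
theorem shareRFastMFD_eq (S : MomSpec M) (K : SymCertR) (hZ : liftOKR K = true) (hD : denseOKR K = true)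
    (gbs : List (List QPoly)) (hm : MomTable M) (κ₂ : Word → ℕ) (J L i f : ℕ) :
    shareRFastMFD S K gbs hm κ₂ J L i f = shareRFastMF S K gbs hm κ₂ J L i f := by
  unfold shareRFastMFD shareRFastMF
  simp only [shareRWithMFD_eq S K hZ hD]

/-- **CLOSING, dense integer dots** (= `energyDensity_ge_of_outroutePMF0` with the dense share; two cheap global facts `hZ`, `hD`). -/
theorem energyDensity_ge_of_outroutePMFD0 (Sm : MomSpec M) (K : SymCertR) (hwf : wellFormed K.expand = true)
    (hRok : K.gramR.all (gramBlockROK K.frame) = true) (oP : PackedNF.PWord → PackedNF.PHint) (hm : MomTable M)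
    (κ₂ : Word → ℕ) (J L : ℕ) (hJ : 0 < J) (hL : 0 < L) (lo hi : ℤ × ℤ) (hbox : boxLicence K.frame lo hi = true)
    (hcov : coverM Sm K (K.gramR.map genBasis) hm = true) (hZ : liftOKR K = true) (hD : denseOKR K = true)
    (hfacts : OutFactsP0 lo hi oP
      (fun m => shareRFastMFD Sm K (K.gramR.map genBasis) hm κ₂ J L (m / L) (m % L)) 0 (J * L)) :
    ((symValueR K : ℚ) : ℝ) ≤ energyDensityTT' 1 0 8 (7 / 8) := by
  have hS : (fun m => shareRFastMFD Sm K (K.gramR.map genBasis) hm κ₂ J L (m / L) (m % L)) =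
      fun m => shareRFastMF Sm K (K.gramR.map genBasis) hm κ₂ J L (m / L) (m % L) := by
    funext m; exact shareRFastMFD_eq Sm K hZ hD _ hm κ₂ J L _ _
  rw [hS] at hfacts
  exact energyDensity_ge_of_outroutePMF0 Sm K hwf hRok oP hm κ₂ J L hJ hL lo hi hbox hcov hfacts

end DenseRows

end Summit.Ventures.CertifiedManyBodySolver.Theorems.SymReplay
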